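import Mathlib.Analysis.SpecialFunctions.Pow.Real
import Literature.RepresentationTheory.FiniteGroups.IrreducibleCharacters
import Summits.MatrixMultiplication.MatrixMultiplication.Theorems.GradedDesignFamily.Negative.ExponentTwoEndpoint

/-!
# Stub `stub_tilingUniversality` for the line `tiling-families` of `LevelGradedCohnUmans.GradedDesignFamily`

Regime II of the family criterion ("asymptotically perfect graded STPP tilings by many small
blocks").  A TILING FAMILY supplies a fixed block-to-dimension ratio `λ > 1` and, for every
efficiency `η < 1`, a finite host `G`, a bi-invariant test space `J ≤ ℂ^G` with graded wall
`D = Σ_{χ ∈ Irr G ∩ J} χ(1)² > 0`, and `t` simultaneously `J`-separated blocks `(X_i, Y_i, Z_i)`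
of volumes `V_i = |X_i| |Y_i| |Z_i|` with `(λ χ(1))³ ≤ V_i` for every visible irreducible `χ`
and `η D ≤ Σ_i V_i^{2/3}`.  This file proves that such a family yields, for every `ε > 0`, a
graded simultaneous family at exponent `2 + ε`:
`Σ_{χ ∈ Irr G ∩ J} χ(1)^{2+ε} < Σ_i V_i^{(2+ε)/3}`.

The proof is power-mean bookkeeping.  Choose `η = λ^{-ε/2}`, so `η < 1` and `η λ^ε = λ^{ε/2} > 1`.
Let `d = max_{χ ∈ Irr ∩ J} χ(1)` (a finite non-empty set since `D > 0`; all degrees `≥ 1`).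
Budget: `χ(1)^{2+ε} = χ(1)² χ(1)^ε ≤ d^ε χ(1)²`, so `B_{2+ε} ≤ d^ε D`.
Value: `V_i ≥ (λ d)³`, so `V_i^{(2+ε)/3} = V_i^{ε/3} V_i^{2/3} ≥ (λ d)^ε V_i^{2/3}` and
`Σ_i V_i^{(2+ε)/3} ≥ (λ d)^ε Σ_i V_i^{2/3} ≥ (λ d)^ε η D = (η λ^ε) (d^ε D) > d^ε D ≥ B_{2+ε}`
(strict because `d^ε D > 0`).
[cite: CohnKleinbergSzegedyUmans2005, Thm. 5.5]
-/

noncomputable section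

set_option linter.dupNamespace false

open scoped BigOperators
open Literature.RepresentationTheory.FiniteGroups

namespace Summit.MatrixMultiplication.MatrixMultiplication.Theorems.GradedDesignFamily

/-- Choice of the efficiency: for `λ > 1` and `ε > 0` there is `η` with `0 < η < 1` and
`1 < η λ^ε` (namely `η = λ^{-ε/2}`, for which `η λ^ε = λ^{ε/2}`). -/
theorem tilingUniversality_eta {lam ε : ℝ} (hlam : 1 < lam) (hε : 0 < ε) :
    ∃ η : ℝ, 0 < η ∧ η < 1 ∧ 1 < η * lam ^ ε := by
  have hlam0 : 0 < lam := by linarith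
  refine ⟨lam ^ (-(ε / 2)), Real.rpow_pos_of_pos hlam0 _,
    Real.rpow_lt_one_of_one_lt_of_neg hlam (by linarith), ?_⟩
  rw [← Real.rpow_add hlam0, show -(ε / 2) + ε = ε / 2 by ring]
  exact Real.one_lt_rpow hlam (by linarith)

/-- The abstract inequality behind `stub_tilingUniversality`: weights `d ≥ 1` on a finite set `S`
with `D = Σ_S d² > 0`, non-negative volumes `V_i` with `(λ d)³ ≤ V_i` on `S` and
`η D ≤ Σ_i V_i^{2/3}`, and `1 < η λ^ε`, `λ > 0`, `ε > 0` give `Σ_S d^{2+ε} < Σ_i V_i^{(2+ε)/3}`. -/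
theorem tilingUniversality_abstract {α : Type*} (S : Finset α) (d : α → ℝ) {t : ℕ}
    (V : Fin t → ℝ) {lam η ε : ℝ} (hlam : 0 < lam) (hε : 0 < ε) (hηlam : 1 < η * lam ^ ε)
    (hd : ∀ χ ∈ S, 1 ≤ d χ) (hV0 : ∀ i, 0 ≤ V i)
    (hpos : 0 < ∑ χ ∈ S, d χ ^ (2 : ℝ))
    (hblk : ∀ i, ∀ χ ∈ S, (lam * d χ) ^ (3 : ℕ) ≤ V i)
    (heff : η * ∑ χ ∈ S, d χ ^ (2 : ℝ) ≤ ∑ i, V i ^ ((2 : ℝ) / 3)) :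
    ∑ χ ∈ S, d χ ^ (2 + ε) < ∑ i, V i ^ ((2 + ε) / 3) := by
  have hSne : S.Nonempty := Finset.nonempty_of_sum_ne_zero hpos.ne'
  obtain ⟨χ₀, hχ₀S, hmax⟩ := S.exists_max_image d hSne
  set D := ∑ χ ∈ S, d χ ^ (2 : ℝ) with hD
  have hdm1 : 1 ≤ d χ₀ := hd χ₀ hχ₀S
  have hdm0 : 0 < d χ₀ := by linarith
  have hld0 : 0 ≤ lam * d χ₀ := by positivity
  -- budget bound: `Σ d^{2+ε} ≤ d_max^ε · D`
  have hB : ∑ χ ∈ S, d χ ^ (2 + ε) ≤ d χ₀ ^ ε * D := by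
    rw [hD, Finset.mul_sum]
    refine Finset.sum_le_sum fun χ hχ => ?_
    have hχ0 : 0 < d χ := by linarith [hd χ hχ]
    rw [Real.rpow_add hχ0, mul_comm]
    exact mul_le_mul_of_nonneg_right (Real.rpow_le_rpow hχ0.le (hmax χ hχ) hε.le)
      (Real.rpow_nonneg hχ0.le _)
  -- value bound: `(λ d_max)^ε · Σ V^{2/3} ≤ Σ V^{(2+ε)/3}`
  have hVal : (lam * d χ₀) ^ ε * ∑ i, V i ^ ((2 : ℝ) / 3) ≤ ∑ i, V i ^ ((2 + ε) / 3) := by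
    rw [Finset.mul_sum]
    refine Finset.sum_le_sum fun i _ => ?_
    have h3 : (lam * d χ₀) ^ (3 : ℝ) ≤ V i := by
      rw [show (3 : ℝ) = ((3 : ℕ) : ℝ) by norm_num, Real.rpow_natCast]
      exact hblk i χ₀ hχ₀S
    have hle : (lam * d χ₀) ^ ε ≤ V i ^ (ε / 3) := by
      have h' : (lam * d χ₀) ^ ε = ((lam * d χ₀) ^ (3 : ℝ)) ^ (ε / 3) := by
        rw [← Real.rpow_mul hld0]
        congr 1
        ring
      rw [h']
      exact Real.rpow_le_rpow (Real.rpow_nonneg hld0 _) h3 (by linarith)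
    calc (lam * d χ₀) ^ ε * V i ^ ((2 : ℝ) / 3)
        ≤ V i ^ (ε / 3) * V i ^ ((2 : ℝ) / 3) :=
          mul_le_mul_of_nonneg_right hle (Real.rpow_nonneg (hV0 i) _)
      _ = V i ^ ((2 + ε) / 3) := by
          rw [← Real.rpow_add_of_nonneg (hV0 i) (by linarith) (by norm_num)]
          congr 1
          ring
  -- strictness: `d_max^ε · D < (η λ^ε) · (d_max^ε · D) = (λ d_max)^ε · (η D)`
  have hDpos : 0 < d χ₀ ^ ε * D := mul_pos (Real.rpow_pos_of_pos hdm0 _) hpos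
  have hstep : d χ₀ ^ ε * D < (lam * d χ₀) ^ ε * (η * D) := by
    rw [Real.mul_rpow hlam.le hdm0.le,
      show lam ^ ε * d χ₀ ^ ε * (η * D) = (η * lam ^ ε) * (d χ₀ ^ ε * D) by ring]
    exact lt_mul_of_one_lt_left hDpos hηlam
  calc ∑ χ ∈ S, d χ ^ (2 + ε) ≤ d χ₀ ^ ε * D := hB
    _ < (lam * d χ₀) ^ ε * (η * D) := hstep
    _ ≤ (lam * d χ₀) ^ ε * ∑ i, V i ^ ((2 : ℝ) / 3) :=
        mul_le_mul_of_nonneg_left heff (Real.rpow_nonneg hld0 _)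
    _ ≤ ∑ i, V i ^ ((2 + ε) / 3) := hVal

/-- **Stub `stub_tilingUniversality`** (line `tiling-families`, registered signature verbatim):
a tiling family — a fixed block-to-dimension ratio `λ > 1` and, for every efficiency `η < 1`, a
finite host with a bi-invariant `J`, positive graded wall `D`, simultaneously `J`-separated
blocks with `(λ χ(1))³ ≤ V_i` for every visible irreducible `χ` and `η D ≤ Σ_i V_i^{2/3}` —
yields for every `ε > 0` a graded simultaneous family at exponent `2 + ε` (the hypothesis of
the landed graded wreath link `gradedWreathLink_proof`).  Proof: `η := λ^{-ε/2}` and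
`tilingUniversality_abstract`. [cite: CohnKleinbergSzegedyUmans2005, Thm. 5.5] -/
theorem stub_tilingUniversality
    (h : ∃ lam : ℝ, 1 < lam ∧ ∀ η : ℝ, η < 1 → ∃ (G : Type) (_ : Group G) (_ : Fintype G)
      (J : Submodule ℂ (G → ℂ)) (t : ℕ) (X Y Z : Fin t → Finset G),
      (∀ f ∈ J, ∀ a b : G, (fun g : G => f (a * g * b)) ∈ J) ∧
      (∀ i : Fin t, ∀ x₀ ∈ X i, ∀ z₀ ∈ Z i, ∃ f ∈ J, ∀ a b : Fin t, ∀ x ∈ X a, ∀ y ∈ Y a,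
        ∀ y' ∈ Y b, ∀ z ∈ Z b,
        ((a = i ∧ b = i ∧ x = x₀ ∧ y = y' ∧ z = z₀) → f (x⁻¹ * y * y'⁻¹ * z) = 1) ∧
        (¬ (a = i ∧ b = i ∧ x = x₀ ∧ y = y' ∧ z = z₀) → f (x⁻¹ * y * y'⁻¹ * z) = 0)) ∧
      (0 < ∑ᶠ χ ∈ Literature.RepresentationTheory.FiniteGroups.irrChars G ∩ (J : Set (G → ℂ)),
        (χ 1).re ^ (2 : ℝ)) ∧
      (∀ i : Fin t, ∀ χ ∈ Literature.RepresentationTheory.FiniteGroups.irrChars G ∩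
        (J : Set (G → ℂ)),
        (lam * (χ 1).re) ^ (3 : ℕ) ≤ (((X i).card * (Y i).card * (Z i).card : ℕ) : ℝ)) ∧
      (η * ∑ᶠ χ ∈ Literature.RepresentationTheory.FiniteGroups.irrChars G ∩ (J : Set (G → ℂ)),
        (χ 1).re ^ (2 : ℝ) ≤
        ∑ i, (((X i).card * (Y i).card * (Z i).card : ℕ) : ℝ) ^ ((2 : ℝ) / 3)))
    (ε : ℝ) (hε : 0 < ε) :
    ∃ (G : Type) (_ : Group G) (_ : Fintype G) (J : Submodule ℂ (G → ℂ)) (t : ℕ)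
      (X Y Z : Fin t → Finset G),
      (∀ f ∈ J, ∀ a b : G, (fun g : G => f (a * g * b)) ∈ J) ∧
      (∀ i : Fin t, ∀ x₀ ∈ X i, ∀ z₀ ∈ Z i, ∃ f ∈ J, ∀ a b : Fin t, ∀ x ∈ X a, ∀ y ∈ Y a,
        ∀ y' ∈ Y b, ∀ z ∈ Z b,
        ((a = i ∧ b = i ∧ x = x₀ ∧ y = y' ∧ z = z₀) → f (x⁻¹ * y * y'⁻¹ * z) = 1) ∧
        (¬ (a = i ∧ b = i ∧ x = x₀ ∧ y = y' ∧ z = z₀) → f (x⁻¹ * y * y'⁻¹ * z) = 0)) ∧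
      (∑ᶠ χ ∈ Literature.RepresentationTheory.FiniteGroups.irrChars G ∩ (J : Set (G → ℂ)),
        (χ 1).re ^ (2 + ε)) <
        ∑ i, (((X i).card * (Y i).card * (Z i).card : ℕ) : ℝ) ^ ((2 + ε) / 3) := by
  obtain ⟨lam, hlam, hfam⟩ := h
  obtain ⟨η, -, hη1, hηlam⟩ := tilingUniversality_eta hlam hε
  obtain ⟨G, hGr, hFt, J, t, X, Y, Z, hJ, hsep, hpos, hblk, heff⟩ := hfam η hη1
  refine ⟨G, hGr, hFt, J, t, X, Y, Z, hJ, hsep, ?_⟩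
  have hfin : (irrChars G ∩ (J : Set (G → ℂ))).Finite :=
    (irrChars_finite_holds G).subset Set.inter_subset_left
  rw [finsum_mem_eq_finite_toFinset_sum _ hfin] at hpos
  rw [finsum_mem_eq_finite_toFinset_sum _ hfin] at heff
  rw [finsum_mem_eq_finite_toFinset_sum _ hfin]
  refine tilingUniversality_abstract hfin.toFinset (fun χ => (χ 1).re)
    (fun i => (((X i).card * (Y i).card * (Z i).card : ℕ) : ℝ)) (by linarith) hε hηlam
    (fun χ hχ => Negative.one_le_re_apply_one (hfin.mem_toFinset.1 hχ).1)
    (fun i => by positivity) hpos (fun i χ hχ => hblk i χ (hfin.mem_toFinset.1 hχ)) heff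

end Summit.MatrixMultiplication.MatrixMultiplication.Theorems.GradedDesignFamily

end
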